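import Summits.QuantumAdvantage.QuantumAdvantage.Theorems.CharDialPartyDialG2

/-!
# PartyDial (decomp-qadv lens-5 g35), part H1 — §7a: the PARITY law (k blind non-splitting pairs, cuts anywhere): blind_law 1 − 4^{-k}

See part A (`CharDialPartyDialA`) for the node header; memo `NODE-g35.md` (g35 folder of decomp-qadv-lens-5).
-/

set_option autoImplicit false
set_option linter.dupNamespace false

namespace Summit.QuantumAdvantage.QuantumAdvantage.Theorems.PartyDial

open Finset
open Summit.QuantumAdvantage.AdviceFreeQNC0

/-! ## §7  The PARITY law: `k` blind pairs, cuts anywhere — and the fan-in sector up to `n^{1-1/k}`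

For segments of size TWO no table game is needed.  Restrict each of `k` disjoint pairs of coordinates to
the three CANONICAL patterns `00, 01, 11` (weights `0, 1, 2`: one representative per class of `ℤ/3`), all
other bits fixed: a grid of `3^k` inputs.  A cut that is BLIND to pair `j` (its output does not depend on
the pair) and does not SPLIT it (both elements before the cut, or both after) sees the pair's weight with a
unit coefficient (`1` or `2`), so along the `j`-line of the grid its address runs through all three residues
mod `3`: it fires at exactly `0` or `2` of the three points (`fire_count_pair`).  Hence every cut fires an
EVEN number of times on the grid, whereas `3^k` winning grid points would make the total ODD
(`blind_grid_loser`).  One loser in every fibre of `4^k` inputs: `blind_law`, `≤ (1 - 4^{-k})·2ⁿ`.  And if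
every cut reads `≤ ℓ` bits with `(n+1)(ℓ+1)^k < (n/2k)^k`, then `k` pairs to each of which every cut is blind
and non-splitting exist by plain counting (`isBlind_of_fanIn`): `fanInLawK` — fan-in up to `≈ n^{1-1/k}/2k`,
every `k`, any wiring, any positions, every charge, degree hypothesis unused. -/

section Blind

variable {n k : ℕ}

/-- canonical bit of a `ℤ/3`-value on a pair: the HIGH element carries `[1 ≤ z]`, the LOW one `[z = 2]`. -/
def pbit (z : Fin 3) (high : Bool) : Bool := if high then decide (1 ≤ z.val) else decide (z.val = 2)

/-- the two canonical bits of `z` weigh `z`. -/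
theorem pbit_weight : ∀ z : Fin 3,
    (if pbit z false = true then 1 else 0) + (if pbit z true = true then 1 else 0) = z.val := by decide

variable (lo hi : Fin k → ℕ)

/-- the `2k` pair coordinates are distinct. -/
def PairsOK : Prop := Function.Injective lo ∧ Function.Injective hi ∧ ∀ j j', lo j ≠ hi j'

/-- the GRID POINT `z` over `t`: canonical patterns on the pairs, `t` elsewhere. -/
def fill (t : Fin n → Bool) (z : Fin k → Fin 3) : Fin n → Bool := fun i =>
  if h : ∃ j : Fin k, i.val = lo j ∨ i.val = hi j then
    pbit (z (Fin.find _ h)) (decide (i.val = hi (Fin.find _ h)))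
  else t i

/-- the free zone: coordinates in no pair. -/
def freeOf : Finset (Fin n) := univ.filter fun i : Fin n => ∀ j : Fin k, i.val ≠ lo j ∧ i.val ≠ hi j

variable {lo hi}

/-- the pair owning a low coordinate. -/
theorem find_lo (hP : PairsOK lo hi) (j : Fin k) {i : ℕ} (hi0 : i = lo j)
    (h : ∃ j' : Fin k, i = lo j' ∨ i = hi j') : Fin.find _ h = j := by
  subst hi0
  rw [Fin.find_eq_iff]
  refine ⟨Or.inl rfl, fun j' hj' hp => ?_⟩
  rcases hp with h1 | h1
  · exact absurd (hP.1 h1).symm (ne_of_lt hj')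
  · exact hP.2.2 j j' h1

/-- the pair owning a high coordinate. -/
theorem find_hi (hP : PairsOK lo hi) (j : Fin k) {i : ℕ} (hi0 : i = hi j)
    (h : ∃ j' : Fin k, i = lo j' ∨ i = hi j') : Fin.find _ h = j := by
  subst hi0
  rw [Fin.find_eq_iff]
  refine ⟨Or.inr rfl, fun j' hj' hp => ?_⟩
  rcases hp with h1 | h1
  · exact hP.2.2 j' j h1.symm
  · exact absurd (hP.2.1 h1).symm (ne_of_lt hj')

/-- grid point at a low coordinate. -/
theorem fill_lo (hP : PairsOK lo hi) (t : Fin n → Bool) (z : Fin k → Fin 3) (j : Fin k) (i : Fin n)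
    (hi0 : i.val = lo j) : fill lo hi t z i = pbit (z j) false := by
  have h : ∃ j' : Fin k, i.val = lo j' ∨ i.val = hi j' := ⟨j, Or.inl hi0⟩
  unfold fill
  rw [dif_pos h, find_lo hP j hi0 h]
  congr 1
  rw [decide_eq_false_iff_not, hi0]
  exact hP.2.2 j j

/-- grid point at a high coordinate. -/
theorem fill_hi (hP : PairsOK lo hi) (t : Fin n → Bool) (z : Fin k → Fin 3) (j : Fin k) (i : Fin n)
    (hi0 : i.val = hi j) : fill lo hi t z i = pbit (z j) true := by
  have h : ∃ j' : Fin k, i.val = lo j' ∨ i.val = hi j' := ⟨j, Or.inr hi0⟩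
  unfold fill
  rw [dif_pos h, find_hi hP j hi0 h]
  congr 1
  rw [decide_eq_true_iff, hi0]

/-- grid point at a free coordinate. -/
theorem fill_free (t : Fin n → Bool) (z : Fin k → Fin 3) (i : Fin n)
    (h : ∀ j : Fin k, i.val ≠ lo j ∧ i.val ≠ hi j) : fill lo hi t z i = t i := by
  have h' : ¬ ∃ j : Fin k, i.val = lo j ∨ i.val = hi j := by
    rintro ⟨j, hj⟩; have := h j; tauto
  unfold fill
  rw [dif_neg h']

/-- moving along the `j`-line of the grid changes only pair `j`. -/
theorem fill_update_off (t : Fin n → Bool) (z : Fin k → Fin 3) (j : Fin k) (x : Fin 3) (i : Fin n)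
    (h : i.val ≠ lo j ∧ i.val ≠ hi j) : fill lo hi t (Function.update z j x) i = fill lo hi t z i := by
  unfold fill
  by_cases he : ∃ j' : Fin k, i.val = lo j' ∨ i.val = hi j'
  · rw [dif_pos he, dif_pos he]
    have hne : Fin.find _ he ≠ j := by
      intro hje
      have hs := Fin.find_spec he
      rw [hje] at hs
      rcases hs with hs | hs
      · exact h.1 hs
      · exact h.2 hs
    rw [Function.update_of_ne hne]
  · rw [dif_neg he, dif_neg he]

/-- the walk exponent with two coordinates removed. -/
def restW (u : Fin n → Bool) (g : ℕ) (L H : Fin n) : ℕ :=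
  (((univ.erase L).erase H).filter fun i => u i = true).card +
    (((univ.erase L).erase H).filter fun i => i.val < g ∧ u i = true).card

/-- … depends only on the other coordinates. -/
theorem restW_congr {u v : Fin n → Bool} (g : ℕ) {L H : Fin n} (h : ∀ i, i ≠ L → i ≠ H → u i = v i) :
    restW u g L H = restW v g L H := by
  have hm : ∀ i ∈ (univ.erase L).erase H, u i = v i := fun i hi =>
    h i (Finset.ne_of_mem_erase (Finset.mem_of_mem_erase hi)) (Finset.ne_of_mem_erase hi)
  unfold restW
  rw [Finset.filter_congr (s := (univ.erase L).erase H) (p := fun i => u i = true) (q := fun i => v i = true)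
      (fun i hi => by rw [hm i hi]),
    Finset.filter_congr (s := (univ.erase L).erase H) (p := fun i => i.val < g ∧ u i = true)
      (q := fun i => i.val < g ∧ v i = true) (fun i hi => by rw [hm i hi])]

/-- a count over all coordinates = the two special ones + the rest. -/
theorem card_filter_split (P : Fin n → Prop) [DecidablePred P] {L H : Fin n} (hLH : L ≠ H) :
    (univ.filter P).card =
      (if P L then 1 else 0) + (if P H then 1 else 0) + (((univ.erase L).erase H).filter P).card := by
  rw [Finset.card_filter, Finset.card_filter, ← Finset.add_sum_erase univ _ (mem_univ L),
    ← Finset.add_sum_erase (univ.erase L) _ (Finset.mem_erase.2 ⟨hLH.symm, mem_univ H⟩)]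
  ring

/-- the walk exponent = rest + the two special coordinates, each weighted `1` (after the cut) or `2`. -/
theorem walkExp_split (u : Fin n → Bool) (g : ℕ) {L H : Fin n} (hLH : L ≠ H) :
    walkExp u g = restW u g L H +
      ((if u L = true then 1 else 0) + (if L.val < g ∧ u L = true then 1 else 0)) +
      ((if u H = true then 1 else 0) + (if H.val < g ∧ u H = true then 1 else 0)) := by
  unfold walkExp wt wtPrefix restW
  rw [card_filter_split (fun i => u i = true) hLH, card_filter_split (fun i => i.val < g ∧ u i = true) hLH]
  ring

/-- two of the three residues are non-zero: a unit-coefficient line fires twice. -/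
theorem card_fire_two (E c : ℕ) (hc : c = 2 ∨ c = 1) :
    (univ.filter fun x : Fin 3 => (E + c * x.val) % 3 ≠ 0).card = 2 := by
  have key : ∀ x : Fin 3, (E + c * x.val) % 3 = (E % 3 + c * x.val) % 3 := by
    intro x
    rw [Nat.add_mod]
    conv_rhs => rw [Nat.add_mod, Nat.mod_mod]
  rw [Finset.filter_congr (q := fun x : Fin 3 => (E % 3 + c * x.val) % 3 ≠ 0) fun x _ => by rw [key x]]
  have hE := Nat.mod_lt E (show 0 < 3 by norm_num)
  obtain ⟨r, hr, hEr⟩ : ∃ r, r < 3 ∧ E % 3 = r := ⟨_, hE, rfl⟩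
  rw [hEr]
  interval_cases r <;> rcases hc with rfl | rfl <;> decide

/-- **Parity along one pair**: a cut blind to pair `j` and not splitting it fires at `0` or `2` of the three
points of any `j`-line of the grid. -/
theorem fire_count_pair (hP : PairsOK lo hi) (hlt : ∀ j, lo j < n ∧ hi j < n) (t : Fin n → Bool) (c : ℕ)
    (y : Fin (n + 1) → (Fin n → Bool) → Bool) (g : Fin (n + 1)) (j : Fin k)
    (hns : lo j < g.val ↔ hi j < g.val)
    (hbl : ∀ u v : Fin n → Bool, (∀ i : Fin n, i.val ≠ lo j → i.val ≠ hi j → u i = v i) → y g u = y g v)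
    (z : Fin k → Fin 3) :
    Even ((univ.filter fun x : Fin 3 => y g (fill lo hi t (Function.update z j x)) = true ∧
      (c + g.val + walkExp (fill lo hi t (Function.update z j x)) g.val) % 3 ≠ 0).card) := by
  set L : Fin n := ⟨lo j, (hlt j).1⟩ with hL
  set H : Fin n := ⟨hi j, (hlt j).2⟩ with hH
  have hLH : L ≠ H := fun h => hP.2.2 j j (by simpa [hL, hH] using congrArg Fin.val h)
  have hoff : ∀ (x : Fin 3) (i : Fin n), i ≠ L → i ≠ H →
      fill lo hi t (Function.update z j x) i = fill lo hi t (Function.update z j 0) i := by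
    intro x i h1 h2
    have h1' : i.val ≠ lo j := fun h => h1 (Fin.ext h)
    have h2' : i.val ≠ hi j := fun h => h2 (Fin.ext h)
    rw [fill_update_off t z j x i ⟨h1', h2'⟩, fill_update_off t z j 0 i ⟨h1', h2'⟩]
  have hy : ∀ x, y g (fill lo hi t (Function.update z j x)) = y g (fill lo hi t (Function.update z j 0)) :=
    fun x => hbl _ _ fun i h1 h2 => hoff x i (fun h => h1 (by rw [h])) (fun h => h2 (by rw [h]))
  have hR : ∀ x, restW (fill lo hi t (Function.update z j x)) g.val L H =
      restW (fill lo hi t (Function.update z j 0)) g.val L H :=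
    fun x => restW_congr g.val fun i h1 h2 => hoff x i h1 h2
  have hvL : ∀ x, fill lo hi t (Function.update z j x) L = pbit x false := fun x => by
    rw [fill_lo hP t _ j L rfl, Function.update_self]
  have hvH : ∀ x, fill lo hi t (Function.update z j x) H = pbit x true := fun x => by
    rw [fill_hi hP t _ j H rfl, Function.update_self]
  set R := restW (fill lo hi t (Function.update z j 0)) g.val L H with hRdef
  have haddr : ∀ x, walkExp (fill lo hi t (Function.update z j x)) g.val =
      R + (if lo j < g.val then 2 else 1) * x.val := by
    intro x
    rw [walkExp_split _ g.val hLH, hR x, hvL x, hvH x]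
    have hw := pbit_weight x
    have eL : (L.val < g.val) = (lo j < g.val) := rfl
    have eH : (H.val < g.val) = (hi j < g.val) := rfl
    by_cases hg : lo j < g.val
    · have hg' : hi j < g.val := hns.1 hg
      simp only [eL, eH, hg, hg', true_and, if_true]
      omega
    · have hg' : ¬ hi j < g.val := fun h => hg (hns.2 h)
      simp only [eL, eH, hg, hg', false_and, if_false, add_zero]
      omega
  by_cases hY : y g (fill lo hi t (Function.update z j 0)) = true
  · have hc : (if lo j < g.val then 2 else 1) = 2 ∨ (if lo j < g.val then 2 else 1) = 1 := by
      split_ifs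
      · exact Or.inl rfl
      · exact Or.inr rfl
    rw [Finset.filter_congr (q := fun x : Fin 3 =>
      (c + g.val + R + (if lo j < g.val then 2 else 1) * x.val) % 3 ≠ 0) fun x _ => by
        rw [hy x, haddr x, ← add_assoc]; exact and_iff_right hY,
      card_fire_two _ _ hc]
    exact even_two
  · rw [Finset.filter_eq_empty_iff.2 fun x _ h => hY (by rw [← hy x]; exact h.1), card_empty]
    exact Even.zero

/-- every such cut fires an EVEN number of times on the whole grid. -/
theorem fire_count_grid_even (hP : PairsOK lo hi) (hlt : ∀ j, lo j < n ∧ hi j < n) (t : Fin n → Bool)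
    (c : ℕ) (y : Fin (n + 1) → (Fin n → Bool) → Bool) (g : Fin (n + 1)) (j : Fin k)
    (hns : lo j < g.val ↔ hi j < g.val)
    (hbl : ∀ u v : Fin n → Bool, (∀ i : Fin n, i.val ≠ lo j → i.val ≠ hi j → u i = v i) → y g u = y g v) :
    Even ((univ.filter fun z : Fin k → Fin 3 => y g (fill lo hi t z) = true ∧
      (c + g.val + walkExp (fill lo hi t z) g.val) % 3 ≠ 0).card) := by
  set F : (Fin k → Fin 3) → Prop := fun z =>
    y g (fill lo hi t z) = true ∧ (c + g.val + walkExp (fill lo hi t z) g.val) % 3 ≠ 0 with hF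
  rw [card_eq_sum_card_fiberwise (f := fun z => Function.update z j 0)
    (t := univ.filter fun z₀ : Fin k → Fin 3 => z₀ j = 0) (fun z _ => by simp)]
  refine Finset.even_sum _ fun z₀ hz₀ => ?_
  have hz₀' : z₀ j = 0 := (mem_filter.1 hz₀).2
  have hset : ((univ.filter F).filter fun z => Function.update z j 0 = z₀) =
      (univ.filter fun x : Fin 3 => F (Function.update z₀ j x)).image fun x => Function.update z₀ j x := by
    ext z
    simp only [mem_filter, mem_univ, true_and, mem_image]
    constructor
    · rintro ⟨hFz, hz⟩
      have hzz : Function.update z₀ j (z j) = z := by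
        rw [← hz, Function.update_idem, Function.update_eq_self]
      exact ⟨z j, by rw [hzz]; exact hFz, hzz⟩
    · rintro ⟨x, hFx, rfl⟩
      refine ⟨hFx, ?_⟩
      rw [Function.update_idem, Function.update_eq_self_iff]
      exact hz₀'.symm
  rw [hset, card_image_of_injective _ fun x x' h => by simpa using congrFun h j]
  exact fire_count_pair hP hlt t c y g j hns hbl z₀

/-- **The grid has a loser**: if every cut is blind to and non-splitting for one of the pairs, then over every
free assignment some grid point loses (cuts fire evenly in total, `3^k` wins would be an odd total). -/
theorem blind_grid_loser (hP : PairsOK lo hi) (hlt : ∀ j, lo j < n ∧ hi j < n) (t : Fin n → Bool) (c : ℕ)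
    (y : Fin (n + 1) → (Fin n → Bool) → Bool)
    (hbl : ∀ g : Fin (n + 1), ∃ j : Fin k, (lo j < g.val ↔ hi j < g.val) ∧
      ∀ u v : Fin n → Bool, (∀ i : Fin n, i.val ≠ lo j → i.val ≠ hi j → u i = v i) → y g u = y g v) :
    ∃ z : Fin k → Fin 3, ringWinU c y (fill lo hi t z) = false := by
  by_contra hall
  push Not at hall
  have hwin : ∀ z : Fin k → Fin 3, (univ.filter fun g : Fin (n + 1) => y g (fill lo hi t z) = true ∧
      (c + g.val + walkExp (fill lo hi t z) g.val) % 3 ≠ 0).card % 2 = 1 := by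
    intro z
    have h := hall z
    unfold ringWinU at h
    simpa using h
  set S := ∑ z : Fin k → Fin 3, (univ.filter fun g : Fin (n + 1) => y g (fill lo hi t z) = true ∧
      (c + g.val + walkExp (fill lo hi t z) g.val) % 3 ≠ 0).card with hS
  have h3 : 3 ^ k % 2 = 1 := by
    rw [Nat.pow_mod]; simp
  have h1 : S % 2 = 1 := by
    rw [hS, Finset.sum_nat_mod, Finset.sum_congr rfl fun z _ => hwin z, Finset.sum_const, smul_eq_mul,
      mul_one, Finset.card_univ, Fintype.card_fun, Fintype.card_fin, Fintype.card_fin, h3]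
  have h2 : Even S := by
    have hc : S = ∑ g : Fin (n + 1), (univ.filter fun z : Fin k → Fin 3 => y g (fill lo hi t z) = true ∧
        (c + g.val + walkExp (fill lo hi t z) g.val) % 3 ≠ 0).card := by
      simp only [hS, Finset.card_filter]
      exact Finset.sum_comm
    rw [hc]
    refine Finset.even_sum _ fun g _ => ?_
    obtain ⟨j, hns, hb⟩ := hbl g
    exact fire_count_grid_even hP hlt t c y g j hns hb
  obtain ⟨m, hm⟩ := h2
  omega

/-- the pair coordinates number at most `2k`. -/
theorem card_compl_freeOf_le : (freeOf lo hi (n := n))ᶜ.card ≤ 2 * k := by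
  have hsub : (freeOf lo hi (n := n))ᶜ ⊆
      (univ : Finset (Fin k)).biUnion fun j => univ.filter fun i : Fin n => i.val = lo j ∨ i.val = hi j := by
    intro i hi
    rw [mem_compl, freeOf, mem_filter, not_and] at hi
    have hi' := hi (mem_univ i)
    push Not at hi'
    obtain ⟨j, hj⟩ := hi'
    rw [mem_biUnion]
    refine ⟨j, mem_univ j, mem_filter.2 ⟨mem_univ i, ?_⟩⟩
    by_cases h : i.val = lo j
    · exact Or.inl h
    · exact Or.inr (hj h)
  have htwo : ∀ j : Fin k, (univ.filter fun i : Fin n => i.val = lo j ∨ i.val = hi j).card ≤ 2 := by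
    intro j
    calc (univ.filter fun i : Fin n => i.val = lo j ∨ i.val = hi j).card
        ≤ ({lo j, hi j} : Finset ℕ).card :=
          Finset.card_le_card_of_injOn (fun i : Fin n => i.val)
            (fun i hi => by
              have h := (mem_filter.1 (Finset.mem_coe.1 hi)).2
              simp only [Finset.coe_insert, Finset.coe_singleton, Set.mem_insert_iff, Set.mem_singleton_iff]
              exact h)
            (Fin.val_injective.injOn)
      _ ≤ 2 := Finset.card_le_two
  calc (freeOf lo hi (n := n))ᶜ.card
      ≤ ((univ : Finset (Fin k)).biUnion fun j =>
          univ.filter fun i : Fin n => i.val = lo j ∨ i.val = hi j).card := card_le_card hsub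
    _ ≤ ∑ j : Fin k, (univ.filter fun i : Fin n => i.val = lo j ∨ i.val = hi j).card := card_biUnion_le
    _ ≤ ∑ _j : Fin k, 2 := sum_le_sum fun j _ => htwo j
    _ = 2 * k := by simp [mul_comm]

/-- **Fibre bound**: over every free assignment at least one of the `2^{#pairs coords}` completions loses. -/
theorem blind_fibre (hP : PairsOK lo hi) (hlt : ∀ j, lo j < n ∧ hi j < n) (c : ℕ)
    (y : Fin (n + 1) → (Fin n → Bool) → Bool)
    (hbl : ∀ g : Fin (n + 1), ∃ j : Fin k, (lo j < g.val ↔ hi j < g.val) ∧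
      ∀ u v : Fin n → Bool, (∀ i : Fin n, i.val ≠ lo j → i.val ≠ hi j → u i = v i) → y g u = y g v)
    (t : Fin n → Bool) :
    ((univ.filter fun a : Fin ((freeOf lo hi (n := n))ᶜ.card) → Bool =>
        ringWinU c y (glue (freeOf lo hi) a t) = true).card : ℝ) ≤
      (2 : ℝ) ^ (freeOf lo hi (n := n))ᶜ.card - 1 := by
  set B := freeOf lo hi (n := n) with hB
  obtain ⟨z, hz⟩ := blind_grid_loser hP hlt t c y hbl
  set u₀ := fill lo hi t z with hu₀
  set a₀ : Fin (Bᶜ.card) → Bool := fun i' => u₀ (emb B i') with ha₀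
  have hglue : glue B a₀ t = u₀ := by
    calc glue B a₀ t = glue B (fun i' => u₀ (emb B i')) (freeP B u₀) := by
          funext i
          unfold glue freeP
          by_cases hi : i ∈ B
          · rw [dif_pos hi, dif_pos hi, if_pos hi, hu₀, fill_free t z i (mem_filter.1 hi).2]
          · rw [dif_neg hi, dif_neg hi]
      _ = u₀ := glue_restrict B u₀
  have hlt' : (univ.filter fun a : Fin (Bᶜ.card) → Bool => ringWinU c y (glue B a t) = true).card <
      (univ : Finset (Fin (Bᶜ.card) → Bool)).card :=
    Finset.card_lt_card (Finset.filter_ssubset.2 ⟨a₀, mem_univ _, by rw [hglue, hz]; decide⟩)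
  rw [Finset.card_univ, Fintype.card_fun, Fintype.card_bool, Fintype.card_fin] at hlt'
  have h' : ((univ.filter fun a : Fin (Bᶜ.card) → Bool => ringWinU c y (glue B a t) = true).card : ℝ) + 1 ≤
      (2 : ℝ) ^ Bᶜ.card := by exact_mod_cast hlt'
  linarith

/-- **Parity law (core)**: `k` distinct pairs, every cut blind to one of them and not splitting it ⟹
`#WIN ≤ (1 - 4^{-k})·2ⁿ`. -/
theorem blind_law_core (hP : PairsOK lo hi) (hlt : ∀ j, lo j < n ∧ hi j < n) (c : ℕ)
    (y : Fin (n + 1) → (Fin n → Bool) → Bool)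
    (hbl : ∀ g : Fin (n + 1), ∃ j : Fin k, (lo j < g.val ↔ hi j < g.val) ∧
      ∀ u v : Fin n → Bool, (∀ i : Fin n, i.val ≠ lo j → i.val ≠ hi j → u i = v i) → y g u = y g v) :
    ((univ.filter fun u : Fin n → Bool => ringWinU c y u = true).card : ℝ) ≤
      (1 - (1 / 4 : ℝ) ^ k) * (2 : ℝ) ^ n := by
  refine law_of_fibres (B := freeOf lo hi) _ c y fun t => (blind_fibre hP hlt c y hbl t).trans ?_
  set m := (freeOf lo hi (n := n))ᶜ.card
  have hm : m ≤ 2 * k := card_compl_freeOf_le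
  have hpos : (0 : ℝ) < (4 : ℝ) ^ k := by positivity
  have h4 : (2 : ℝ) ^ m ≤ (4 : ℝ) ^ k := by
    calc (2 : ℝ) ^ m ≤ (2 : ℝ) ^ (2 * k) := pow_le_pow_right₀ (by norm_num) hm
      _ = (4 : ℝ) ^ k := by rw [pow_mul]; norm_num
  have hle : (2 : ℝ) ^ m * (1 / 4 : ℝ) ^ k ≤ 1 := by
    rw [one_div_pow, mul_one_div, div_le_one hpos]; exact h4
  calc (2 : ℝ) ^ m - 1 ≤ (2 : ℝ) ^ m - (2 : ℝ) ^ m * (1 / 4 : ℝ) ^ k := by linarith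
    _ = (1 - (1 / 4 : ℝ) ^ k) * (2 : ℝ) ^ m := by ring

/-- a strategy is `k`-BLIND: there are `k` disjoint pairs of coordinates such that EVERY cut is blind to
(does not depend on) at least one of the pairs and does not split that pair.  Cuts sit anywhere; what the
cuts read besides (other pairs, everything else) is unrestricted. -/
def IsBlind (k : ℕ) (y : Fin (n + 1) → (Fin n → Bool) → Bool) : Prop :=
  ∃ lo hi : Fin k → ℕ, (Function.Injective lo ∧ Function.Injective hi ∧ ∀ j j', lo j ≠ hi j') ∧
    (∀ j, lo j < n ∧ hi j < n) ∧
    ∀ g : Fin (n + 1), ∃ j : Fin k, (lo j < g.val ↔ hi j < g.val) ∧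
      ∀ u v : Fin n → Bool, (∀ i : Fin n, i.val ≠ lo j → i.val ≠ hi j → u i = v i) → y g u = y g v

/-- ★★ **The PARITY LAW**: a `k`-blind strategy wins with probability `≤ 1 - 4^{-k}`, every charge. -/
theorem blind_law {k : ℕ} (c : ℕ) (y : Fin (n + 1) → (Fin n → Bool) → Bool) (hy : IsBlind k y) :
    ((univ.filter fun u : Fin n → Bool => ringWinU c y u = true).card : ℝ) ≤
      (1 - (1 / 4 : ℝ) ^ k) * (2 : ℝ) ^ n := by
  obtain ⟨lo, hi, hP, hlt, hbl⟩ := hy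
  exact blind_law_core hP hlt c y hbl

end Blind

end Summit.QuantumAdvantage.QuantumAdvantage.Theorems.PartyDial
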